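import Literature.ModelTheory.ExponentialFields.CylindricalDecompositionProofs

/-!
# `GenusTwoRealPeriodCell` (stmt-KontsevichZagierPeriods-17657), line `Sketch` — stub `stub_fibreEqTwo`

**Two-set adapted cylindrical decomposition, fibre form.** For two `ℚ`-semialgebraic sets
`σ, τ ⊆ ℝⁿ⁺¹` there is ONE cylindrical decomposition `𝒮` of `ℝⁿ` (Basu–Pollack–Roy, Def. 5.1:
`IsCylindricalDecomposition ℚ n 𝒮`, so `𝒮` partitions `ℝⁿ` into `ℚ`-semialgebraic cells) carrying,
over each cell `S ∈ 𝒮`, continuous `ℚ`-semialgebraic pointwise strictly increasing sections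
`ξ_{S,0} < ⋯ < ξ_{S,ℓ_S-1}` with `ℚ`-semialgebraic graphs and bands, such that BOTH `σ` and `τ` have,
over every cell `S`, vertical fibres `{t | (x, t) ∈ σ}` (resp. `τ`) equal to a FIXED (independent of
`x ∈ S`) finite union of section values `ξ_{S,j} x`, `j ∈ G`, and open bands
`(ξ_{S,j-1} x, ξ_{S,j} x)`, `j ∈ B` (extended-real conventions `ξ_{S,-1} = -∞`, `ξ_{S,ℓ_S} = +∞`).

This is the two-set version of the one-set corollary
`Literature.ModelTheory.ExponentialFields.IsSemialgebraic.exists_cylindricalDecomposition.exists_fibre_eq`,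
with the same proof: apply the PROVED adapted-decomposition theorem
`Literature.ModelTheory.ExponentialFields.IsSemialgebraic.exists_cylindricalDecomposition_holds`
(Basu–Pollack–Roy, Cor. 5.7) to the finite family `{σ, τ}`; the decomposition `𝒯` of `ℝⁿ⁺¹` is the
stack of graphs and bands over a decomposition `𝒮` of `ℝⁿ`, and each of `σ`, `τ` is a union of a
subfamily `𝒞 ⊆ 𝒯`; a cell of `𝒞` meeting the fibre over `x ∈ S` lies above the unique base cell
containing `x`, namely `S` (`fibre_eq_of_subset_stack`, the per-set argument, used twice).

References: S. Basu, R. Pollack, M.-F. Roy, *Algorithms in Real Algebraic Geometry*, 2nd ed.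
(2006), Def. 5.1, Thm. 5.6, Cor. 5.7.
-/

noncomputable section

open Set MeasureTheory Filter
open Literature.NumberTheory.Transcendental
open Literature.ModelTheory.ExponentialFields (IsSemialgebraic IsCylindricalDecomposition graphOver
  bandOver bandLower bandUpper snoc_mem_graphOver_iff snoc_mem_bandOver_iff)

namespace Summit.KontsevichZagierPeriods.IsogenyCertificates.GenusTwoRealPeriodCellLine

/-- **Fibre structure of a union of cells of a cylinder stack over one base cell.** If `𝒯` is the
stack of the graphs `graphOver S (ξ S j)` and bands `bandOver S (ξ S) j` over the members `S` of a
partition `𝒮` of `ℝⁿ`, and `s = ⋃₀ 𝒞` for a subfamily `𝒞 ⊆ 𝒯`, then over each `S ∈ 𝒮` the vertical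
fibres of `s` are the FIXED union of the section values `ξ_{S,j} x` whose graphs belong to `𝒞` and
the bands `(ξ_{S,j-1} x, ξ_{S,j} x)` whose band cells belong to `𝒞`: a cell of `𝒞` containing
`(x, t)` with `x ∈ S` lies over the unique member of `𝒮` containing `x`.
[cite: BasuPollackRoy2006, Cor. 5.7] -/
theorem fibre_eq_of_subset_stack {n : ℕ} {𝒯 : Finset (Set (Fin (n + 1) → ℝ))}
    {𝒮 : Finset (Set (Fin n → ℝ))} (h𝒮part : Setoid.IsPartition (𝒮 : Set (Set (Fin n → ℝ))))
    {l : Set (Fin n → ℝ) → ℕ} {ξ : (S : Set (Fin n → ℝ)) → Fin (l S) → (Fin n → ℝ) → ℝ}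
    (hmem : ∀ T, T ∈ 𝒯 ↔ ∃ S ∈ 𝒮, (∃ j, T = graphOver S (ξ S j)) ∨ ∃ j, T = bandOver S (ξ S) j)
    {s : Set (Fin (n + 1) → ℝ)} {𝒞 : Finset (Set (Fin (n + 1) → ℝ))} (h𝒞𝒯 : 𝒞 ⊆ 𝒯)
    (hsU : ⋃₀ (𝒞 : Set (Set (Fin (n + 1) → ℝ))) = s) {S : Set (Fin n → ℝ)} (hS : S ∈ 𝒮) :
    ∃ (G : Finset (Fin (l S))) (B : Finset (Fin (l S + 1))),
      (∀ j ∈ G, graphOver S (ξ S j) ⊆ s) ∧ (∀ j ∈ B, bandOver S (ξ S) j ⊆ s) ∧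
      ∀ x ∈ S, {t : ℝ | (Fin.snoc x t : Fin (n + 1) → ℝ) ∈ s} =
        (⋃ j ∈ G, {ξ S j x}) ∪
          ⋃ j ∈ B, {t : ℝ | bandLower (ξ S) j x < t ∧ (t : EReal) < bandUpper (ξ S) j x} := by
  classical
  -- adapted from `IsSemialgebraic.exists_cylindricalDecomposition.exists_fibre_eq`
  -- (Literature/ModelTheory/ExponentialFields/CylindricalDecomposition.lean)
  refine ⟨Finset.univ.filter fun j => graphOver S (ξ S j) ∈ 𝒞,
    Finset.univ.filter fun j => bandOver S (ξ S) j ∈ 𝒞, ?_, ?_, fun x hx => ?_⟩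
  · intro j hj
    rw [Finset.mem_filter] at hj
    rw [← hsU]
    exact subset_sUnion_of_mem hj.2
  · intro j hj
    rw [Finset.mem_filter] at hj
    rw [← hsU]
    exact subset_sUnion_of_mem hj.2
  · ext t
    simp only [mem_setOf_eq, mem_union, mem_iUnion, Finset.mem_filter, Finset.mem_univ, true_and,
      mem_singleton_iff, exists_prop]
    constructor
    · intro ht
      rw [← hsU] at ht
      obtain ⟨T, hT𝒞, hzT⟩ := mem_sUnion.1 ht
      obtain ⟨S', hS', hT⟩ := (hmem T).1 (h𝒞𝒯 hT𝒞)
      have hxS' : x ∈ S' := by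
        rcases hT with ⟨j, rfl⟩ | ⟨j, rfl⟩
        · exact (snoc_mem_graphOver_iff.1 hzT).1
        · exact (snoc_mem_bandOver_iff.1 hzT).1
      obtain rfl : S' = S := by
        obtain ⟨U, -, huniq⟩ := h𝒮part.2 x
        exact (huniq S' ⟨hS', hxS'⟩).trans (huniq S ⟨hS, hx⟩).symm
      rcases hT with ⟨j, rfl⟩ | ⟨j, rfl⟩
      · exact Or.inl ⟨j, hT𝒞, (snoc_mem_graphOver_iff.1 hzT).2⟩
      · exact Or.inr ⟨j, hT𝒞, (snoc_mem_bandOver_iff.1 hzT).2⟩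
    · rintro (⟨j, hj, rfl⟩ | ⟨j, hj, ht⟩)
      · rw [← hsU]
        exact mem_sUnion.2 ⟨_, hj, snoc_mem_graphOver_iff.2 ⟨hx, rfl⟩⟩
      · rw [← hsU]
        exact mem_sUnion.2 ⟨_, hj, snoc_mem_bandOver_iff.2 ⟨hx, ht⟩⟩

/-- **Two-set adapted cylindrical decomposition, fibre form.** For `ℚ`-semialgebraic
`σ, τ ⊆ ℝⁿ⁺¹` there is a cylindrical decomposition `𝒮` of `ℝⁿ` with continuous `ℚ`-semialgebraic
strictly increasing sections `ξ_S` over each cell such that BOTH `σ` and `τ` have, over every cell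
`S`, vertical fibres equal to a FIXED finite union of section values and bands
(`IsSemialgebraic.exists_cylindricalDecomposition_holds` run for the family `{σ, τ}`, then the
per-set fibre argument `fibre_eq_of_subset_stack` for each of `σ`, `τ`).
[cite: BasuPollackRoy2006, Cor. 5.7] -/
theorem stub_fibreEqTwo : ∀ {n : ℕ} {σ τ : Set (Fin (n + 1) → ℝ)},
    IsSemialgebraic ℚ σ → IsSemialgebraic ℚ τ →
    ∃ (𝒮 : Finset (Set (Fin n → ℝ))) (l : Set (Fin n → ℝ) → ℕ)
      (ξ : (S : Set (Fin n → ℝ)) → Fin (l S) → (Fin n → ℝ) → ℝ),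
      IsCylindricalDecomposition ℚ n 𝒮 ∧
      (∀ S ∈ 𝒮, ∀ j, ContinuousOn (ξ S j) S) ∧
      (∀ S ∈ 𝒮, ∀ j, IsSemialgebraicFunOn ℚ S (ξ S j)) ∧
      (∀ S ∈ 𝒮, ∀ x ∈ S, StrictMono fun j => ξ S j x) ∧
      (∀ S ∈ 𝒮, (∀ j, IsSemialgebraic ℚ (graphOver S (ξ S j))) ∧
        ∀ j, IsSemialgebraic ℚ (bandOver S (ξ S) j)) ∧
      (∀ S ∈ 𝒮, ∃ (G : Finset (Fin (l S))) (B : Finset (Fin (l S + 1))),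
        (∀ j ∈ G, graphOver S (ξ S j) ⊆ σ) ∧ (∀ j ∈ B, bandOver S (ξ S) j ⊆ σ) ∧
        ∀ x ∈ S, {t : ℝ | (Fin.snoc x t : Fin (n + 1) → ℝ) ∈ σ} =
          (⋃ j ∈ G, {ξ S j x}) ∪
            ⋃ j ∈ B, {t : ℝ | bandLower (ξ S) j x < t ∧ (t : EReal) < bandUpper (ξ S) j x}) ∧
      (∀ S ∈ 𝒮, ∃ (G : Finset (Fin (l S))) (B : Finset (Fin (l S + 1))),
        (∀ j ∈ G, graphOver S (ξ S j) ⊆ τ) ∧ (∀ j ∈ B, bandOver S (ξ S) j ⊆ τ) ∧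
        ∀ x ∈ S, {t : ℝ | (Fin.snoc x t : Fin (n + 1) → ℝ) ∈ τ} =
          (⋃ j ∈ G, {ξ S j x}) ∪
            ⋃ j ∈ B, {t : ℝ | bandLower (ξ S) j x < t ∧ (t : EReal) < bandUpper (ξ S) j x}) := by
  classical
  intro n σ τ hσ hτ
  obtain ⟨𝒯, h𝒯, had⟩ :=
    (Literature.ModelTheory.ExponentialFields.IsSemialgebraic.exists_cylindricalDecomposition_holds
      (k := ℚ)) ({σ, τ} : Finset (Set (Fin (n + 1) → ℝ)))
      (fun s hs => by
        rw [Finset.mem_insert, Finset.mem_singleton] at hs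
        rcases hs with rfl | rfl
        · exact hσ
        · exact hτ)
  obtain ⟨𝒞σ, h𝒞σ, hσU⟩ := had σ (Finset.mem_insert_self σ _)
  obtain ⟨𝒞τ, h𝒞τ, hτU⟩ := had τ (Finset.mem_insert_of_mem (Finset.mem_singleton_self τ))
  obtain ⟨-, h𝒯sa, 𝒮, h𝒮, l, ξ, hcont, hsa, hmono, hmem⟩ := h𝒯
  have h𝒮part := h𝒮.isPartition
  refine ⟨𝒮, l, ξ, h𝒮, hcont, hsa, hmono, fun S hS => ⟨fun j => ?_, fun j => ?_⟩,
    fun S hS => fibre_eq_of_subset_stack h𝒮part hmem h𝒞σ hσU hS,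
    fun S hS => fibre_eq_of_subset_stack h𝒮part hmem h𝒞τ hτU hS⟩
  · exact h𝒯sa _ ((hmem _).2 ⟨S, hS, Or.inl ⟨j, rfl⟩⟩)
  · exact h𝒯sa _ ((hmem _).2 ⟨S, hS, Or.inr ⟨j, rfl⟩⟩)

end Summit.KontsevichZagierPeriods.IsogenyCertificates.GenusTwoRealPeriodCellLine

end
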